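import Summits.QuantumFields.QCD.Theorems.HeatSlicedQuarksQuarkLoopCoefficientAssemblyAux

/-!
# The quark-loop coefficient (crux stmt-QuantumFields-16786, line `Sketch`): composition

`Summit.QuantumFields.QCD.Theses.HeatSlicedQuarks.QuarkLoopCoefficient` (rank-7 crux of route HeatSlicedQuarks):
for Cartan-diagonal `SU(3)` fields on `T_L = (ℤ/L)⁴` with plaquette `diag(e^{iθ},e^{−iθ},1)` in the `(0,1)` plane
and all other plaquettes trivial, the colour–spin traced on-diagonal correction
`Δ_U(t,x) = Σ_{aα} Re[e^{−tH_U} − e^{−tH_1}]((x,a,α),(x,a,α))`, `H = D_Wᴴ D_W` (massless, `r = 1`), obeys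
`|Δ − (1 − cos θ)/(3π²)| ≤ Cθ²(1/t + θ²t²) + Ce^{−cL²/(t+L)}/t²` for `1 ≤ t ≤ L²`, `t|θ| ≤ 1`.

This file is the sorry-free skeleton `Cruxes/QuarkLoopCoefficient/Lines/Sketch.lean` with its seven registered stubs
discharged by the landed theorems (all in namespace `Summit.QuantumFields.QCD.Cruxes.QuarkLoopCoefficient.Sketch`):

* `stub_windowBound` (`…WindowBound.lean`): window regime `c₀ < t|θ| ≤ 1` — every on-site diagonal entry of
  `K_U(t)` is `≤ C/t²` (closed crux 8871 + diagonal monotonicity);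
* `stub_torusToPlane` (`…TorusToPlane.lean`): colour decoupling, exponential-series periodization `T_L ← ℤ⁴`,
  abelian gauge classification and magnetic-translation covariance:
  `K_U(t)((x,a,α),(x,a,α)) = Σ_{n∈ℤ⁴} c_n E^{(q_aθ)}_t(Ln)_{αα}`, `c_0 = 1`, `|c_n| = 1`, `E = symHeat`;
* `stub_gaussianMajorant` (`…GaussianMajorant.lean`): `‖E^{(θ)}_t(w)‖ ≤ C(1+t)⁻²e^{−c|w|²/(1+t+|w|)}` for
  `|θ| ≤ c₀`, `|θ|t ≤ c₀` (Peierls-dressed free parametrix, first Moyal cancellation, smallness bootstrap);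
* `stub_secondOrderExpansion` (`…SecondOrderExpansion.lean`): `tr[E^{(θ)}_t(0) − E^{(0)}_t(0)] = θa₁ + θ²·e2 t + θ³a₃
  + O(θ⁴t²)`;
* `stub_secondOrderCoefficient` (`…SecondOrderCoefficient.lean`): `|e2 t − 1/(12π²)| ≤ C/t`;
* `stub_freeMajorantToolkit` (`…FreeMajorantToolkit.lean`): Gaussian bound of the free kernel and the profile
  calculus, incl. the image sum `Σ_{n≠0} Γ_c(t, Ln) ≤ Ce^{−(c/2)L²/(t+L)}/t²`;
* `stub_freeHeatCalculus` (`…FreeHeatCalculus.lean`): the free symbol, heat equation, semigroup and IBP identities.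

The composition below (`traced_bound`, `QuarkLoopCoefficient_of`) is unchanged from the registered skeleton: window
regime by `stub_windowBound` (for `U` and `U ≡ 1`); core regime `t|θ| ≤ c₀` through `stub_torusToPlane`, the images
`n ≠ 0` by the Gaussian majorant summed with toolkit (6), the `n = 0` terms by the second-order expansion at `±θ`
(odd orders cancel; colour `2` cancels exactly against the free kernel) and the coefficient asymptotics, and
`|θ²/2 − (1 − cos θ)| ≤ 5θ⁴/96`.
-/

noncomputable section

namespace Summit.QuantumFields.QCD.Cruxes.QuarkLoopCoefficient.Sketch

open Literature.MathematicalPhysics.QuantumLattice Literature.MathematicalPhysics.QuantumFieldTheory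
open Literature.Probability.LatticeModels (Site TorusSite)
open Summit.QuantumFields.QCD.Theses.HeatSlicedQuarks
open Summit.QuantumFields.QCD.Theorems.QuarkLoopCoefficient
open Summit.QuantumFields.QCD.Cruxes.QuarkLoopCoefficient.Sketch.FreeMajorantToolkit (gaussProfile_nonneg)
open scoped Matrix ComplexConjugate

/-! ### `traced_bound`: the estimate for abstract periodized diagonal kernels -/

/-- The analytic heart of the composition, with the two on-site kernels abstracted: given the window bounds
(`stub_windowBound`) and the twisted periodizations (`stub_torusToPlane`) of `K_U` and `K_1` at the twelve
colour–spin indices, the traced difference is within the crux's envelope of `(1 − cos θ)/(3π²)`. -/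
theorem traced_bound (C_W : ℝ) : ∃ C c : ℝ, 0 < c ∧ ∀ (L : ℕ), 1 ≤ L → ∀ (θ t : ℝ),
    1 ≤ t → t ≤ (L : ℝ) ^ 2 → t * |θ| ≤ 1 → ∀ (KU K1 : Fin 3 → Fin 4 → ℂ),
    (∀ (a : Fin 3) (α : Fin 4), ‖KU a α‖ ≤ C_W / t ^ 2) →
    (∀ (a : Fin 3) (α : Fin 4), ‖K1 a α‖ ≤ C_W / t ^ 2) →
    (∀ (a : Fin 3) (α : Fin 4), ∃ c : Site 4 → ℂ, c 0 = 1 ∧ (∀ n, ‖c n‖ = 1) ∧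
        HasSum (fun n : Site 4 => c n * symHeat (charge a θ) t (fun μ => (L : ℤ) * n μ) α α) (KU a α)) →
    (∀ (a : Fin 3) (α : Fin 4), ∃ c : Site 4 → ℂ, c 0 = 1 ∧ (∀ n, ‖c n‖ = 1) ∧
        HasSum (fun n : Site 4 => c n * symHeat (charge a 0) t (fun μ => (L : ℤ) * n μ) α α) (K1 a α)) →
    |(∑ a : Fin 3, ∑ α : Fin 4, (KU a α).re) - (∑ a : Fin 3, ∑ α : Fin 4, (K1 a α).re) -
        (1 - Real.cos θ) / (3 * Real.pi ^ 2)| ≤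
      C * θ ^ 2 * (1 / t + θ ^ 2 * t ^ 2) + C * Real.exp (-(c * (L : ℝ) ^ 2 / (t + (L : ℝ)))) / t ^ 2 := by
  classical
  obtain ⟨c₁, hc₁, C_G, c_G, hc_G, hG⟩ := gaussianMajorant_holds
  obtain ⟨c₂, hc₂, C_E, a₁, a₃, hE⟩ := secondOrderExpansion_holds
  obtain ⟨C_κ, hκ⟩ := secondOrderCoefficient_holds
  obtain ⟨C_I, hI⟩ := stub_freeMajorantToolkit.2.2.2.2.2 c_G hc_G
  -- nonnegative versions of the constants
  set CW : ℝ := max C_W 0 with hCWdef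
  set CG : ℝ := max C_G 0 with hCGdef
  set CE : ℝ := max C_E 0 with hCEdef
  set Cκ : ℝ := max C_κ 0 with hCκdef
  set CI : ℝ := max C_I 0 with hCIdef
  have hCW0 : 0 ≤ CW := le_max_right _ _
  have hCG0 : 0 ≤ CG := le_max_right _ _
  have hCE0 : 0 ≤ CE := le_max_right _ _
  have hCκ0 : 0 ≤ Cκ := le_max_right _ _
  have hCI0 : 0 ≤ CI := le_max_right _ _
  have hCWle : C_W ≤ CW := le_max_left _ _
  have hCGle : C_G ≤ CG := le_max_left _ _
  have hCEle : C_E ≤ CE := le_max_left _ _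
  have hCκle : C_κ ≤ Cκ := le_max_left _ _
  have hCIle : C_I ≤ CI := le_max_left _ _
  set c₀ : ℝ := min (min c₁ c₂) 1 with hc₀def
  have hc₀ : 0 < c₀ := lt_min (lt_min hc₁ hc₂) one_pos
  have hc₀₁ : c₀ ≤ c₁ := (min_le_left _ _).trans (min_le_left _ _)
  have hc₀₂ : c₀ ≤ c₂ := (min_le_left _ _).trans (min_le_right _ _)
  have hc₀1 : c₀ ≤ 1 := min_le_right _ _
  set Cwin : ℝ := 24 * CW / c₀ ^ 4 + 1 / (6 * Real.pi ^ 2 * c₀ ^ 2) with hCwindef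
  have hCwin0 : 0 ≤ Cwin := by positivity
  set C : ℝ := max (max (2 * Cκ) (2 * CE + 5 / 96 + Cwin)) (24 * CG * CI) with hCdef
  have hC1 : 2 * Cκ ≤ C := (le_max_left _ _).trans (le_max_left _ _)
  have hC2 : 2 * CE + 5 / 96 + Cwin ≤ C := (le_max_right _ _).trans (le_max_left _ _)
  have hC3 : 24 * CG * CI ≤ C := le_max_right _ _
  have hC0 : 0 ≤ C := le_trans (by positivity) hC3
  clear_value CW CG CE Cκ CI c₀ Cwin C
  refine ⟨C, c_G / 2, by positivity, ?_⟩
  intro L hL1 θ t ht htL htθ KU K1 hKUw hK1w hrepU hrepF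
  have ht0 : 0 < t := lt_of_lt_of_le one_pos ht
  have ht2 : 0 < t ^ 2 := by positivity
  -- the exponential tail factor
  set Etail : ℝ := Real.exp (-(c_G / 2 * (L : ℝ) ^ 2 / (t + (L : ℝ)))) with hEtaildef
  have hEtail0 : 0 ≤ Etail := (Real.exp_pos _).le
  -- restate the goal additively
  suffices key : |(∑ a : Fin 3, ∑ α : Fin 4, (KU a α).re) - (∑ a : Fin 3, ∑ α : Fin 4, (K1 a α).re) -
      (1 - Real.cos θ) / (3 * Real.pi ^ 2)| ≤
      C * θ ^ 2 / t + C * θ ^ 4 * t ^ 2 + C * Etail / t ^ 2 by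
    have hrhs : C * θ ^ 2 / t + C * θ ^ 4 * t ^ 2 + C * Etail / t ^ 2 =
        C * θ ^ 2 * (1 / t + θ ^ 2 * t ^ 2) + C * Etail / t ^ 2 := by
      field_simp
    rw [hrhs] at key
    exact key
  -- main term abbreviation
  set mterm : ℝ := (1 - Real.cos θ) / (3 * Real.pi ^ 2) with hmtermdef
  by_cases hcore : t * |θ| ≤ c₀
  · /- CORE regime -/
    have hθc₀ : |θ| ≤ c₀ := by
      have : |θ| ≤ t * |θ| := le_mul_of_one_le_left (abs_nonneg θ) ht
      exact this.trans hcore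
    have hθ1 : |θ| ≤ 1 := hθc₀.trans hc₀1
    -- twisted periodizations of both kernels (hypotheses `hrepU`, `hrepF`)
    choose cU hcU0 hcU1 hsumU using hrepU
    choose cF hcF0 hcF1 hsumF using hrepF
    -- the image majorant
    obtain ⟨hIsum, hIle⟩ := hI L hL1 t ht htL
    set Γimg : Site 4 → ℝ := fun n => CG * gaussProfile c_G t (fun μ => (L : ℤ) * n μ) with hΓimgdef
    have hΓsum : Summable Γimg := hIsum.mul_left CG
    have hΓ0 : ∀ n, 0 ≤ Γimg n := fun n => mul_nonneg hCG0 (gaussProfile_nonneg _ _ _)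
    have hΓtail : ∑' n : Site 4, (if n = 0 then 0 else Γimg n) ≤ CG * CI * Etail / t ^ 2 := by
      have hfun : (fun n : Site 4 => if n = 0 then (0:ℝ) else Γimg n) =
          fun n => CG * (if n = 0 then 0 else gaussProfile c_G t (fun μ => (L : ℤ) * n μ)) := by
        funext n; split_ifs <;> simp [hΓimgdef]
      rw [hfun, tsum_mul_left]
      have h1 : ∑' n : Site 4, (if n = 0 then 0 else gaussProfile c_G t (fun μ => (L : ℤ) * n μ)) ≤
          CI * Etail / t ^ 2 := by
        refine hIle.trans ?_
        have : C_I * Etail / t ^ 2 ≤ CI * Etail / t ^ 2 :=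
          div_le_div_of_nonneg_right (mul_le_mul_of_nonneg_right hCIle hEtail0) ht2.le
        simpa [hEtaildef] using this
      calc CG * ∑' n : Site 4, (if n = 0 then 0 else gaussProfile c_G t (fun μ => (L : ℤ) * n μ))
          ≤ CG * (CI * Etail / t ^ 2) := mul_le_mul_of_nonneg_left h1 hCG0
        _ = CG * CI * Etail / t ^ 2 := by ring
    -- entrywise majorant of the heat symbol for charges `|q| ≤ |θ|`
    have hmaj : ∀ q : ℝ, |q| ≤ |θ| → ∀ (w : Site 4) (α β : Fin 4),
        ‖symHeat q t w α β‖ ≤ CG * gaussProfile c_G t w := by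
      intro q hq w α β
      have hq1 : |q| ≤ c₁ := hq.trans (hθc₀.trans hc₀₁)
      have hq2 : |q| * t ≤ c₁ := by
        calc |q| * t ≤ |θ| * t := mul_le_mul_of_nonneg_right hq ht0.le
          _ = t * |θ| := by ring
          _ ≤ c₁ := hcore.trans hc₀₁
      exact (hG q t ht0.le hq1 hq2 w α β).trans
        (mul_le_mul_of_nonneg_right hCGle (gaussProfile_nonneg _ _ _))
    -- tails
    have htailU : ∀ (a : Fin 3) (α : Fin 4),
        ‖KU a α - symHeat (charge a θ) t 0 α α‖ ≤ CG * CI * Etail / t ^ 2 := by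
      intro a α
      have h0 : cU a α 0 * symHeat (charge a θ) t (fun μ => (L : ℤ) * (0 : Site 4) μ) α α =
          symHeat (charge a θ) t 0 α α := by
        rw [hcU0, one_mul, deck_zero]
      have := image_tail (hsumU a α) hΓsum hΓ0 (fun n hn => by
        rw [norm_mul, hcU1, one_mul]
        exact hmaj _ (abs_charge_le a θ) _ α α)
      rw [h0] at this
      exact this.trans hΓtail
    have htailF : ∀ (a : Fin 3) (α : Fin 4),
        ‖K1 a α - symHeat 0 t 0 α α‖ ≤ CG * CI * Etail / t ^ 2 := by
      intro a α
      have h0 : cF a α 0 * symHeat (charge a 0) t (fun μ => (L : ℤ) * (0 : Site 4) μ) α α =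
          symHeat 0 t 0 α α := by
        rw [hcF0, one_mul, deck_zero, charge_zero]
      have := image_tail (hsumF a α) hΓsum hΓ0 (fun n hn => by
        rw [norm_mul, hcF1, one_mul, charge_zero]
        exact hmaj 0 (by simp) _ α α)
      rw [h0] at this
      exact this.trans hΓtail
    -- the `n = 0` terms: `G q = tr[E^{(q)}_t(0) − E^{(0)}_t(0)]`
    set G : ℝ → ℂ := fun q => ∑ α : Fin 4, (symHeat q t 0 α α - symHeat 0 t 0 α α) with hGdef
    have hG0 : G 0 = 0 := by simp [hGdef]
    -- second-order expansion at `±θ`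
    have hθt₂ : |θ| * t ≤ c₂ := by rw [mul_comm]; exact hcore.trans hc₀₂
    have hEp := hE θ t ht hθt₂
    have hEm := hE (-θ) t ht (by rwa [abs_neg])
    have hexp : ‖G θ + G (-θ) - 2 * (θ : ℂ) ^ 2 * e2 t‖ ≤ 2 * CE * θ ^ 4 * t ^ 2 := by
      have e1 : G θ + G (-θ) - 2 * (θ : ℂ) ^ 2 * e2 t =
          (G θ - ((θ : ℂ) * a₁ t + (θ : ℂ) ^ 2 * e2 t + (θ : ℂ) ^ 3 * a₃ t)) +
          (G (-θ) - ((((-θ : ℝ)) : ℂ) * a₁ t + (((-θ : ℝ)) : ℂ) ^ 2 * e2 t + (((-θ : ℝ)) : ℂ) ^ 3 * a₃ t)) := by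
        push_cast; ring
      rw [e1]
      refine (norm_add_le _ _).trans ?_
      have hb1 : ‖G θ - ((θ : ℂ) * a₁ t + (θ : ℂ) ^ 2 * e2 t + (θ : ℂ) ^ 3 * a₃ t)‖ ≤ CE * θ ^ 4 * t ^ 2 :=
        hEp.trans (by gcongr)
      have hb2 : ‖G (-θ) - ((((-θ : ℝ)) : ℂ) * a₁ t + (((-θ : ℝ)) : ℂ) ^ 2 * e2 t + (((-θ : ℝ)) : ℂ) ^ 3 * a₃ t)‖ ≤
          CE * θ ^ 4 * t ^ 2 := by
        refine hEm.trans ?_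
        have : (-θ) ^ 4 = θ ^ 4 := by ring
        rw [this]
        gcongr
      linarith
    -- the coefficient
    have hcoef : |2 * θ ^ 2 * (e2 t).re - θ ^ 2 / (6 * Real.pi ^ 2)| ≤ 2 * Cκ * θ ^ 2 / t := by
      have hk := hκ t ht
      have e1 : 2 * θ ^ 2 * (e2 t).re - θ ^ 2 / (6 * Real.pi ^ 2) =
          2 * θ ^ 2 * (e2 t - ((1 / (12 * Real.pi ^ 2) : ℝ) : ℂ)).re := by
        simp only [Complex.sub_re, Complex.ofReal_re]
        ring
      rw [e1, abs_mul, abs_of_nonneg (by positivity : (0:ℝ) ≤ 2 * θ ^ 2)]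
      calc 2 * θ ^ 2 * |(e2 t - ((1 / (12 * Real.pi ^ 2) : ℝ) : ℂ)).re|
          ≤ 2 * θ ^ 2 * (C_κ / t) :=
            mul_le_mul_of_nonneg_left ((Complex.abs_re_le_norm _).trans hk) (by positivity)
        _ ≤ 2 * θ ^ 2 * (Cκ / t) := by gcongr
        _ = 2 * Cκ * θ ^ 2 / t := by ring
    have hcos := cos_main_term hθ1
    -- decompose the traced difference
    have hdecomp : (∑ a : Fin 3, ∑ α : Fin 4, (KU a α).re) - (∑ a : Fin 3, ∑ α : Fin 4, (K1 a α).re) =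
        ((G θ).re + (G (-θ)).re) +
        ∑ a : Fin 3, ∑ α : Fin 4, ((KU a α - symHeat (charge a θ) t 0 α α) - (K1 a α - symHeat 0 t 0 α α)).re := by
      have hGsum : ∑ a : Fin 3, (G (charge a θ)).re = (G θ).re + (G (-θ)).re := by
        rw [sum_charge (fun q => (G q).re) θ, hG0]; simp
      rw [← hGsum]
      simp only [hGdef, Complex.re_sum, Complex.sub_re, Finset.sum_sub_distrib]
      ring
    -- bound the image part
    have himg : |∑ a : Fin 3, ∑ α : Fin 4,
        ((KU a α - symHeat (charge a θ) t 0 α α) - (K1 a α - symHeat 0 t 0 α α)).re| ≤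
        24 * CG * CI * Etail / t ^ 2 := by
      refine (Finset.abs_sum_le_sum_abs _ _).trans ?_
      have hin : ∀ a : Fin 3, |∑ α : Fin 4,
          ((KU a α - symHeat (charge a θ) t 0 α α) - (K1 a α - symHeat 0 t 0 α α)).re| ≤
          ∑ _α : Fin 4, 2 * (CG * CI * Etail / t ^ 2) := by
        intro a
        refine (Finset.abs_sum_le_sum_abs _ _).trans (Finset.sum_le_sum fun α _ => ?_)
        refine (Complex.abs_re_le_norm _).trans ?_
        refine (norm_sub_le _ _).trans ?_
        linarith [htailU a α, htailF a α]
      calc ∑ a : Fin 3, |∑ α : Fin 4, ((KU a α - symHeat (charge a θ) t 0 α α) - (K1 a α - symHeat 0 t 0 α α)).re|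
          ≤ ∑ _a : Fin 3, ∑ _α : Fin 4, 2 * (CG * CI * Etail / t ^ 2) := Finset.sum_le_sum fun a _ => hin a
        _ = 24 * CG * CI * Etail / t ^ 2 := by
          simp only [Finset.sum_const, Finset.card_univ, Fintype.card_fin, nsmul_eq_mul]
          ring
    -- the real part of the `n = 0` terms
    have hmain : |(G θ).re + (G (-θ)).re - mterm| ≤
        2 * CE * θ ^ 4 * t ^ 2 + 2 * Cκ * θ ^ 2 / t + 5 / 96 * θ ^ 4 := by
      have hre : |(G θ).re + (G (-θ)).re - 2 * θ ^ 2 * (e2 t).re| ≤ 2 * CE * θ ^ 4 * t ^ 2 := by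
        have h2 : (G θ + G (-θ) - 2 * (θ : ℂ) ^ 2 * e2 t).re = (G θ).re + (G (-θ)).re - 2 * θ ^ 2 * (e2 t).re := by
          have e3 : (2 * (θ : ℂ) ^ 2 * e2 t) = ((2 * θ ^ 2 : ℝ) : ℂ) * e2 t := by push_cast; ring
          rw [Complex.sub_re, Complex.add_re, e3, Complex.re_ofReal_mul]
        rw [← h2]
        exact (Complex.abs_re_le_norm _).trans hexp
      have htri : |(G θ).re + (G (-θ)).re - mterm| ≤
          |(G θ).re + (G (-θ)).re - 2 * θ ^ 2 * (e2 t).re| +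
          |2 * θ ^ 2 * (e2 t).re - θ ^ 2 / (6 * Real.pi ^ 2)| +
          |θ ^ 2 / (6 * Real.pi ^ 2) - mterm| := by
        have := abs_add_three ((G θ).re + (G (-θ)).re - 2 * θ ^ 2 * (e2 t).re)
          (2 * θ ^ 2 * (e2 t).re - θ ^ 2 / (6 * Real.pi ^ 2)) (θ ^ 2 / (6 * Real.pi ^ 2) - mterm)
        have e : (G θ).re + (G (-θ)).re - mterm =
            ((G θ).re + (G (-θ)).re - 2 * θ ^ 2 * (e2 t).re) +
            (2 * θ ^ 2 * (e2 t).re - θ ^ 2 / (6 * Real.pi ^ 2)) + (θ ^ 2 / (6 * Real.pi ^ 2) - mterm) := by ring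
        rw [e]; exact this
      linarith [hre, hcoef, hcos, htri]
    -- assemble the core bound
    have hθ4 : θ ^ 4 ≤ θ ^ 4 * t ^ 2 := by
      have h1t : (1:ℝ) ≤ t ^ 2 := by simpa using pow_le_pow_left₀ zero_le_one ht 2
      exact le_mul_of_one_le_right (by positivity) h1t
    have hsplit : |(∑ a : Fin 3, ∑ α : Fin 4, (KU a α).re) - (∑ a : Fin 3, ∑ α : Fin 4, (K1 a α).re) - mterm| ≤
        |(G θ).re + (G (-θ)).re - mterm| +
        |∑ a : Fin 3, ∑ α : Fin 4, ((KU a α - symHeat (charge a θ) t 0 α α) - (K1 a α - symHeat 0 t 0 α α)).re| := by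
      rw [hdecomp]
      have e : (G θ).re + (G (-θ)).re +
          ∑ a : Fin 3, ∑ α : Fin 4, ((KU a α - symHeat (charge a θ) t 0 α α) - (K1 a α - symHeat 0 t 0 α α)).re -
          mterm = ((G θ).re + (G (-θ)).re - mterm) +
          ∑ a : Fin 3, ∑ α : Fin 4, ((KU a α - symHeat (charge a θ) t 0 α α) - (K1 a α - symHeat 0 t 0 α α)).re := by
        ring
      rw [e]; exact abs_add_le _ _
    have hθ2t : 0 ≤ θ ^ 2 / t := by positivity
    have hθ4t : 0 ≤ θ ^ 4 * t ^ 2 := by positivity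
    have hEt : 0 ≤ Etail / t ^ 2 := by positivity
    calc |(∑ a : Fin 3, ∑ α : Fin 4, (KU a α).re) - (∑ a : Fin 3, ∑ α : Fin 4, (K1 a α).re) - mterm|
        ≤ (2 * CE * θ ^ 4 * t ^ 2 + 2 * Cκ * θ ^ 2 / t + 5 / 96 * θ ^ 4) + 24 * CG * CI * Etail / t ^ 2 := by
          linarith [hsplit, hmain, himg]
      _ = (2 * Cκ) * (θ ^ 2 / t) + (2 * CE + 5 / 96 + Cwin) * (θ ^ 4 * t ^ 2) + (24 * CG * CI) * (Etail / t ^ 2) -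
            (5 / 96 * (θ ^ 4 * t ^ 2 - θ ^ 4) + Cwin * (θ ^ 4 * t ^ 2)) := by ring
      _ ≤ (2 * Cκ) * (θ ^ 2 / t) + (2 * CE + 5 / 96 + Cwin) * (θ ^ 4 * t ^ 2) + (24 * CG * CI) * (Etail / t ^ 2) := by
          have hx : 0 ≤ Cwin * (θ ^ 4 * t ^ 2) := mul_nonneg hCwin0 hθ4t
          have hy : 0 ≤ θ ^ 4 * t ^ 2 - θ ^ 4 := sub_nonneg.mpr hθ4
          have hz : 0 ≤ 5 / 96 * (θ ^ 4 * t ^ 2 - θ ^ 4) + Cwin * (θ ^ 4 * t ^ 2) := by positivity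
          linarith [hz]
      _ ≤ C * (θ ^ 2 / t) + C * (θ ^ 4 * t ^ 2) + C * (Etail / t ^ 2) := by
          gcongr
      _ = C * θ ^ 2 / t + C * θ ^ 4 * t ^ 2 + C * Etail / t ^ 2 := by ring
  · /- WINDOW regime -/
    push Not at hcore
    -- both kernels are `≤ C_W/t²` entrywise
    have hKU : ∀ (a : Fin 3) (α : Fin 4), ‖KU a α‖ ≤ CW / t ^ 2 := fun a α =>
      (hKUw a α).trans (div_le_div_of_nonneg_right hCWle ht2.le)
    have hK1 : ∀ (a : Fin 3) (α : Fin 4), ‖K1 a α‖ ≤ CW / t ^ 2 := fun a α =>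
      (hK1w a α).trans (div_le_div_of_nonneg_right hCWle ht2.le)
    have hsumK : ∀ K : Fin 3 → Fin 4 → ℂ, (∀ a α, ‖K a α‖ ≤ CW / t ^ 2) →
        |∑ a : Fin 3, ∑ α : Fin 4, (K a α).re| ≤ 12 * (CW / t ^ 2) := by
      intro K hK
      refine (Finset.abs_sum_le_sum_abs _ _).trans ?_
      have hin : ∀ a : Fin 3, |∑ α : Fin 4, (K a α).re| ≤ ∑ _α : Fin 4, CW / t ^ 2 := fun a =>
        (Finset.abs_sum_le_sum_abs _ _).trans
          (Finset.sum_le_sum fun α _ => (Complex.abs_re_le_norm _).trans (hK a α))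
      calc ∑ a : Fin 3, |∑ α : Fin 4, (K a α).re| ≤ ∑ _a : Fin 3, ∑ _α : Fin 4, CW / t ^ 2 :=
            Finset.sum_le_sum fun a _ => hin a
        _ = 12 * (CW / t ^ 2) := by
            simp only [Finset.sum_const, Finset.card_univ, Fintype.card_fin, nsmul_eq_mul]; ring
    have hU := hsumK KU hKU
    have hF := hsumK K1 hK1
    -- the main term is `≤ θ²/(6π²)` and nonnegative
    have hm0 : 0 ≤ mterm := div_nonneg (by linarith [Real.cos_le_one θ]) (by positivity)
    have hm1 : mterm ≤ θ ^ 2 / (6 * Real.pi ^ 2) := by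
      have hc : 1 - Real.cos θ ≤ θ ^ 2 / 2 := by linarith [Real.one_sub_sq_div_two_le_cos (x := θ)]
      have : θ ^ 2 / 2 / (3 * Real.pi ^ 2) = θ ^ 2 / (6 * Real.pi ^ 2) := by ring
      rw [hmtermdef, ← this]
      exact div_le_div_of_nonneg_right hc (by positivity)
    -- conversion of `1/t²` and `θ²` into `θ⁴t²` using `c₀ < t|θ|`
    have hθt : c₀ < |θ| * t := by rwa [mul_comm] at hcore
    have hprod4 : c₀ ^ 4 < (|θ| * t) ^ 4 := pow_lt_pow_left₀ hθt hc₀.le (by norm_num)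
    have hprod2 : c₀ ^ 2 < (|θ| * t) ^ 2 := pow_lt_pow_left₀ hθt hc₀.le (by norm_num)
    have habs2 : |θ| ^ 2 = θ ^ 2 := sq_abs θ
    have habs4 : |θ| ^ 4 = θ ^ 4 := by
      have : |θ| ^ 4 = (|θ| ^ 2) ^ 2 := by ring
      rw [this, sq_abs]; ring
    have hconv1 : 1 / t ^ 2 ≤ θ ^ 4 * t ^ 2 / c₀ ^ 4 := by
      rw [div_le_div_iff₀ ht2 (by positivity)]
      have : c₀ ^ 4 ≤ θ ^ 4 * t ^ 4 := by
        have := hprod4.le; rw [mul_pow, habs4] at this; exact this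
      have e : θ ^ 4 * t ^ 2 * t ^ 2 = θ ^ 4 * t ^ 4 := by ring
      rw [e]; linarith [this]
    have hconv2 : θ ^ 2 ≤ θ ^ 4 * t ^ 2 / c₀ ^ 2 := by
      rw [le_div_iff₀ (by positivity)]
      have : c₀ ^ 2 ≤ θ ^ 2 * t ^ 2 := by
        have := hprod2.le; rw [mul_pow, habs2] at this; exact this
      have h' := mul_le_mul_of_nonneg_left this (sq_nonneg θ)
      have e : θ ^ 2 * (θ ^ 2 * t ^ 2) = θ ^ 4 * t ^ 2 := by ring
      rw [e] at h'; exact h'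
    have hθ2t : 0 ≤ θ ^ 2 / t := by positivity
    have hθ4t : 0 ≤ θ ^ 4 * t ^ 2 := by positivity
    have hEt : 0 ≤ Etail / t ^ 2 := by positivity
    have htri : |(∑ a : Fin 3, ∑ α : Fin 4, (KU a α).re) - (∑ a : Fin 3, ∑ α : Fin 4, (K1 a α).re) - mterm| ≤
        |∑ a : Fin 3, ∑ α : Fin 4, (KU a α).re| + |∑ a : Fin 3, ∑ α : Fin 4, (K1 a α).re| + |mterm| :=
      (abs_sub _ _).trans (by gcongr; exact abs_sub _ _)
    have hmabs : |mterm| ≤ θ ^ 2 / (6 * Real.pi ^ 2) := by rw [abs_of_nonneg hm0]; exact hm1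
    calc |(∑ a : Fin 3, ∑ α : Fin 4, (KU a α).re) - (∑ a : Fin 3, ∑ α : Fin 4, (K1 a α).re) - mterm|
        ≤ 24 * CW * (1 / t ^ 2) + θ ^ 2 / (6 * Real.pi ^ 2) := by
          have : 12 * (CW / t ^ 2) + 12 * (CW / t ^ 2) = 24 * CW * (1 / t ^ 2) := by ring
          linarith [htri, hU, hF, hmabs]
      _ ≤ 24 * CW * (θ ^ 4 * t ^ 2 / c₀ ^ 4) + (θ ^ 4 * t ^ 2 / c₀ ^ 2) / (6 * Real.pi ^ 2) := by
          gcongr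
      _ = Cwin * (θ ^ 4 * t ^ 2) := by
          rw [hCwindef]; field_simp
      _ ≤ (2 * Cκ) * (θ ^ 2 / t) + (2 * CE + 5 / 96 + Cwin) * (θ ^ 4 * t ^ 2) + (24 * CG * CI) * (Etail / t ^ 2) := by
          have hx1 : 0 ≤ (2 * Cκ) * (θ ^ 2 / t) := mul_nonneg (by positivity) hθ2t
          have hx2 : 0 ≤ (2 * CE + 5 / 96) * (θ ^ 4 * t ^ 2) := mul_nonneg (by positivity) hθ4t
          have hx3 : 0 ≤ (24 * CG * CI) * (Etail / t ^ 2) := mul_nonneg (by positivity) hEt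
          linarith [hx1, hx2, hx3]
      _ ≤ C * (θ ^ 2 / t) + C * (θ ^ 4 * t ^ 2) + C * (Etail / t ^ 2) := by
          gcongr
      _ = C * θ ^ 2 / t + C * θ ^ 4 * t ^ 2 + C * Etail / t ^ 2 := by ring

/-! ### The crux -/

/-- **The crux** `HeatSlicedQuarks.QuarkLoopCoefficient`, concluded BY NAME from the seven landed `stub_*` theorems of
the line `Sketch` (through `traced_bound`): window
regime `c₀ < t|θ|` by `stub_windowBound` (for `U` and for `U ≡ 1`); core regime `t|θ| ≤ c₀` by
`stub_torusToPlane` (for `U` and `U ≡ 1`), the images by `gaussianMajorant_holds` summed with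
`stub_freeMajorantToolkit` (6), the `n = 0` terms by `secondOrderExpansion_holds` at `±θ` (odd orders cancel) and
`secondOrderCoefficient_holds`, and `|θ²/2 − (1 − cos θ)| ≤ 5θ⁴/96`. -/
theorem QuarkLoopCoefficient_of :
    Summit.QuantumFields.QCD.Theses.HeatSlicedQuarks.QuarkLoopCoefficient := by
  obtain ⟨C_W, hW⟩ := stub_windowBound
  obtain ⟨C, c, hc, hmain⟩ := traced_bound C_W
  refine ⟨C, c, hc, ?_⟩
  intro L _ U θ h1 h2 h3 t ht htL htθ x
  have hL1 : 1 ≤ L := Nat.one_le_iff_ne_zero.mpr (NeZero.ne L)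
  have ht0 : 0 ≤ t := le_trans zero_le_one ht
  exact hmain L hL1 θ t ht htL htθ
    (fun a α => torusHeat U t (x, a, α) (x, a, α))
    (fun a α => torusHeat (fun _ : Edge 4 L => (1 : Matrix.specialUnitaryGroup (Fin 3) ℂ)) t (x, a, α) (x, a, α))
    (fun a α => hW L U θ h1 h2 h3 t ht htL htθ x a α)
    (fun a α => hW L (fun _ : Edge 4 L => (1 : Matrix.specialUnitaryGroup (Fin 3) ℂ)) 0 (free_offdiag L)
      (free_flux L) (free_flat L) t ht htL (by simp) x a α)
    (fun a α => stub_torusToPlane L U θ h1 h2 h3 t ht0 x a α)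
    (fun a α => stub_torusToPlane L (fun _ : Edge 4 L => (1 : Matrix.specialUnitaryGroup (Fin 3) ℂ)) 0
      (free_offdiag L) (free_flux L) (free_flat L) t ht0 x a α)

end Summit.QuantumFields.QCD.Cruxes.QuarkLoopCoefficient.Sketch

end
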